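import Summits.BirchSwinnertonDyer.BirchSwinnertonDyer.Theorems.GenusKolyvaginAtTwoGenusPrimitiveSupplyAtTwoArchimedeanTwist
import Summits.BirchSwinnertonDyer.BirchSwinnertonDyer.Theorems.GenusKolyvaginAtTwoGenusPrimitiveSupplyAtTwoArchimedeanTransverse
import HarnessLib

/-!
# Route `GenusKolyvaginAtTwo`, crux #2 `GenusPrimitiveSupplyAtTwo` (stmt-BirchSwinnertonDyer-22136):
# the T-A dichotomy with a single REAL `T`-place — modulo {PT, Tate χ, Kramer parity} ONLY (the transversality at `∞` discharged)

Width seat `bsd-line-gk2-p5` g9 (cell `bsd-f1-sign2`, SUPPLY lineage, «UP general-K lane»), file 24 of the series (capstone of files 18–23: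
`…ArchimedeanCount`, `…ArchimedeanKummerCount`, `…ArchimedeanTransfer`, `…ArchimedeanKummerCard`, `…ArchimedeanTwist`, `…ArchimedeanTwoTorsion`,
`…ArchimedeanTransverse`). THEOREMS ONLY (no definition, no named fact, no `sorry`, no local instance); helper `--supports stmt-BirchSwinnertonDyer-22136`;
no item is closed; BSD is not proved by any of this.

WHAT. File 21's `GenusKolyArch.natCard_selmerGroup_twist_shift_of_places_inl_of_parity` (Mazur–Rubin Cor. 3.4 (i) / the cell's T-A dichotomy for
the twist pair `(E, E^{(d)})` whose only `T`-place is a real place `w₀`, from the place menus) displayed two data: an intertwining pair `φ, ψ`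
with its split-place agreement, and the transversality at `w₀`. File 23's `exists_intertwining_hsplit_and_transverse_inl` supplies both for the
canonical identification. Hence:

* §59 `natCard_selmerGroup_twist_shift_of_places_inl` — for `W/K` with `ρ̄_{W,2}` onto, `d` a non-square in `K` AND in `K_{w₀}`, `w₀` real
  with `w₀(Δ_W) > 0`, finite places on the menu {split | odd good both | odd silent both}, other infinite places on the menu {split | `H¹ = 0`
  both}: `#Sel₂(Wd)·2 = #Sel₂(W) ∨ #Sel₂(Wd) = #Sel₂(W)·2`, CONDITIONAL on `hPT` (Milne I 4.10), `hEP` (Milne I 2.8) and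
  `hKP : MazurRubin2010.kramerParity K` (Mazur–Rubin Thm. 2.7) only;
* §60 `natCard_selmerGroup_silentTwin_shift` — over `ℚ`: `W` globally minimal, `ρ̄_{W,2}` onto, `Δ_W > 0`, `K` imaginary quadratic with
  `d_K = −ℓ` odd, Heegner for `N_W`, `2` split, `ℓ` SILENT for `W` and for the twist model `Wd` (`#W(ℚ_ℓ)[2] = #Wd(ℚ_ℓ)[2] = 1`):
  `#Sel₂(Wd)·2 = #Sel₂(W) ∨ #Sel₂(Wd) = #Sel₂(W)·2` — the cell's T-A row `F1Sign2.AdmissibleTwistSelmerShiftAtTwo` on the habitat for prime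
  descent-admissible `d = −ℓ`, modulo {PT, Tate χ, Kramer parity}, same currency as §36 (the `Δ_W < 0` twin).

References: [MazurRubin2010] Thm. 2.7, Lemmas 2.9–2.11, Prop. 3.3, Cor. 3.4 (i); [Kramer1981] §2 Prop. 6, Thm. 1; [MilneADT2006] I Thm. 2.8, 2.13,
4.10; [GrossLMS1991] §1 (p. 235).
-/

set_option linter.dupNamespace false -- tree convention: `Summit.BirchSwinnertonDyer.BirchSwinnertonDyer.Theorems` (summit = sub-problem)
set_option autoImplicit false

noncomputable section

open scoped Classical ContRepresentation

namespace Summit.BirchSwinnertonDyer.BirchSwinnertonDyer.Theorems.GenusKolyArch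

open WeierstrassCurve Field NumberField IsDedekindDomain Function
open Literature.NumberTheory.EllipticCurves Literature.NumberTheory.GaloisRepresentations
open Literature.NumberTheory.GaloisCohomology
open Summit.BirchSwinnertonDyer.BirchSwinnertonDyer.Theorems.GenusKolyTwistLocal
open Rat.HeightOneSpectrum (primesEquiv natGenerator)

/-! ## §59 The T-A dichotomy with a single real `T`-place, modulo {PT, Tate χ, Kramer parity} -/

section Places

variable {K : Type} [Field K] [NumberField K] (W : WeierstrassCurve K) [W.IsElliptic]

/-- **Cor. 3.4 (i) / T-A DICHOTOMY with a single REAL `T`-place — kernel theorem modulo Poitou–Tate duality, Tate's χ and Kramer's congruence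
BY NAME, nothing else displayed.** `W/K` elliptic with `ρ̄_{W,2}` onto, `Wd = C • W^{(d)}` elliptic, `d` not a square in `K` nor in `K_{w₀}`,
`w₀` a real place with `w₀(Δ_W) > 0`, every finite place on the menu {split | odd & good for both | odd & silent for both}, every other infinite
place on the menu {split | `H¹ = 0` for both}: then `#Sel₂(Wd)·2 = #Sel₂(W)` or `#Sel₂(Wd) = #Sel₂(W)·2`.
[cite: MazurRubin2010, Thm. 2.7, Lemma 2.9, Prop. 3.3, Cor. 3.4 (i)] [cite: Kramer1981, §2 Prop. 6, Thm. 1] [cite: MilneADT2006, I Thm. 2.13, 4.10] -/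
theorem natCard_selmerGroup_twist_shift_of_places_inl
    (hPT : poitouTate_selmerStructure_duality_real K)
    (hEP : ∀ v : HeightOneSpectrum (𝓞 K), localEulerPoincareCharacteristic (v.adicCompletion K))
    (hKP : MazurRubin2010.kramerParity K) (hsurj : W.HasSurjectiveModNGaloisRep 2)
    {d : K} (hdsq : ∀ x : K, x ^ 2 ≠ d) {Wd : WeierstrassCurve K} [Wd.IsElliptic] {C : VariableChange K}
    (hWd : C • W.quadraticTwist d = Wd)
    {w₀ : InfinitePlace K} (hw₀ : w₀.IsReal) (hΔ : 0 < InfinitePlace.embedding_of_isReal hw₀ W.Δ)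
    (hdsq₀ : ∀ s : w₀.Completion, s ^ 2 ≠ algebraMap K w₀.Completion d)
    (hfin : ∀ v : HeightOneSpectrum (𝓞 K),
      (∃ s : v.adicCompletion K, s ^ 2 = algebraMap K (v.adicCompletion K) d) ∨
      (((2 : ℕ) : 𝓞 K) ∉ v.asIdeal ∧ W.HasGoodReductionAt v ∧ Wd.HasGoodReductionAt v) ∨
      (((2 : ℕ) : 𝓞 K) ∉ v.asIdeal ∧
        Nat.card (nsmulAddMonoidHom 2 : (W.baseChange (v.adicCompletion K)).toAffine.Point →+ _).ker = 1 ∧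
        Nat.card (nsmulAddMonoidHom 2 : (Wd.baseChange (v.adicCompletion K)).toAffine.Point →+ _).ker = 1))
    (hinf : ∀ w : InfinitePlace K, w ≠ w₀ →
      (∃ s : w.Completion, s ^ 2 = algebraMap K w.Completion d) ∨
      ((∀ x : galoisCohomology (W.localGaloisModule w.Completion) 1, x = 0) ∧
        (∀ x : galoisCohomology (Wd.localGaloisModule w.Completion) 1, x = 0))) :
    Nat.card (Wd.selmerGroup ((2 : ℕ) : ℤ)) * 2 = Nat.card (W.selmerGroup ((2 : ℕ) : ℤ)) ∨
      Nat.card (Wd.selmerGroup ((2 : ℕ) : ℤ)) = Nat.card (W.selmerGroup ((2 : ℕ) : ℤ)) * 2 := by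
  have hd : d ≠ 0 := fun h ↦ hdsq 0 (by rw [h]; ring)
  obtain ⟨φ, ψ, hψφ, hφψ, hsplit, hreal⟩ := exists_intertwining_hsplit_and_transverse_inl W hd hWd
  exact natCard_selmerGroup_twist_shift_of_places_inl_of_parity W hPT hEP hKP hsurj hdsq hWd φ ψ hψφ hφψ hsplit hw₀ hΔ
    hfin hinf (hreal w₀ hw₀ hΔ hdsq₀)

end Places

/-! ## §60 Over `ℚ`: the SILENT prime Heegner twin on `Δ_W > 0` -/

section Rat

variable (W : WeierstrassCurve ℚ) [W.IsElliptic]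

/-- A negative rational number is not a square in `ℝ = ℚ_∞` (the completion at the infinite place). [folklore] -/
theorem forall_sq_ne_completion_of_neg {q : ℚ} (hq : q < 0) (w : InfinitePlace ℚ) :
    ∀ s : w.Completion, s ^ 2 ≠ algebraMap ℚ w.Completion q := by
  have hw : w.IsReal := by rw [Subsingleton.elim w Rat.infinitePlace]; exact Rat.isReal_infinitePlace
  intro s hs
  have h := congrArg (InfinitePlace.Completion.ringEquivRealOfIsReal hw) hs
  rw [map_pow, ringEquivRealOfIsReal_algebraMap hw, embedding_of_isReal_rat_apply] at h
  have h0 : (0 : ℝ) ≤ (q : ℝ) := by rw [← h]; exact sq_nonneg _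
  exact absurd (by exact_mod_cast h0 : (0 : ℚ) ≤ q) (not_le.mpr hq)

/-- **T-A on the habitat for the SILENT prime Heegner twin, `Δ_W > 0` — kernel theorem modulo {PT, Tate χ, Kramer parity} ONLY.** `W/ℚ`
globally minimal elliptic with `ρ̄_{W,2}` onto and `Δ_W > 0`; `K` imaginary quadratic with `d_K = −ℓ` odd (`ℓ` prime), Heegner for `N_W`,
`2` split in `K`; `ℓ` SILENT for `W` and for the twist model `Wd` of `W^{(d_K)}` (`#W(ℚ_ℓ)[2] = #Wd(ℚ_ℓ)[2] = 1`): then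
`#Sel₂(Wd)·2 = #Sel₂(W)` or `#Sel₂(Wd) = #Sel₂(W)·2` (Mazur–Rubin Cor. 3.4 (i) with `T = {∞}`: DOWN iff some Selmer class of `W` is
non-trivial at `∞`, UP iff `Sel₂(W)` is strict at `∞` — the cell's descent sign). Companion of §36 (`Δ_W < 0`, `T = {ℓ}`).
[cite: MazurRubin2010, Thm. 2.7, Lemma 2.9, Lemma 2.10, Prop. 3.3, Cor. 3.4 (i)] [cite: Kramer1981, §2 Prop. 6, Thm. 1]
[cite: MilneADT2006, I Thm. 2.13, 4.10] [cite: GrossLMS1991, §1 (p. 235)] -/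
theorem natCard_selmerGroup_silentTwin_shift [W.IsGloballyMinimal] {K : Type} [Field K] [NumberField K]
    (hPT : poitouTate_selmerStructure_duality_real ℚ)
    (hEP : ∀ v : HeightOneSpectrum (𝓞 ℚ), localEulerPoincareCharacteristic (v.adicCompletion ℚ))
    (hKP : MazurRubin2010.kramerParity ℚ) (hsurj : W.HasSurjectiveModNGaloisRep 2) (hΔ : 0 < W.Δ)
    (hK : IsImaginaryQuadratic K) (hodd : Odd (discr K)) (hH : SatisfiesHeegnerHypothesis (W.conductorNorm ℤ) K)
    (h2K : ((Ideal.span {(2 : ℤ)}).primesOver (𝓞 K)).ncard = 2)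
    {ℓ : ℕ} [Fact ℓ.Prime] (hd : discr K = -(ℓ : ℤ)) {Wd : WeierstrassCurve ℚ} [Wd.IsElliptic]
    (hWd : ∃ C : VariableChange ℚ, C • W.quadraticTwist (discr K : ℚ) = Wd)
    (hℓW : Nat.card (nsmulAddMonoidHom 2 : (W.baseChange ℚ_[ℓ]).toAffine.Point →+ _).ker = 1)
    (hℓWd : Nat.card (nsmulAddMonoidHom 2 : (Wd.baseChange ℚ_[ℓ]).toAffine.Point →+ _).ker = 1) :
    Nat.card (Wd.selmerGroup 2) * 2 = Nat.card (W.selmerGroup 2) ∨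
      Nat.card (Wd.selmerGroup 2) = Nat.card (W.selmerGroup 2) * 2 := by
  have hℓ : ℓ.Prime := Fact.out
  obtain ⟨C, hC⟩ := hWd
  have hd0 : (discr K : ℚ) ≠ 0 := by
    rw [hd]; push_cast; exact neg_ne_zero.mpr (by exact_mod_cast hℓ.ne_zero)
  have hdneg : (discr K : ℚ) < 0 := by
    rw [hd]; push_cast; exact neg_neg_of_pos (by exact_mod_cast hℓ.pos)
  obtain ⟨φ, ψ, hψφ, hφψ, hsplit, hreal⟩ := exists_intertwining_hsplit_and_transverse_inl W hd0 hC
  set w₀ : InfinitePlace ℚ := Rat.infinitePlace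
  have hw₀ : w₀.IsReal := Rat.isReal_infinitePlace
  have hΔ' : 0 < InfinitePlace.embedding_of_isReal hw₀ W.Δ := by rwa [embedding_of_isReal_rat_apply, Rat.cast_pos]
  exact natCard_selmerGroup_silentTwin_shift_of_parity W hPT hEP hKP hsurj hΔ hK hodd hH h2K hd ⟨C, hC⟩ hℓW hℓWd φ ψ hψφ hφψ
    hsplit w₀ (hreal w₀ hw₀ hΔ' (forall_sq_ne_completion_of_neg hdneg w₀))

end Rat

end Summit.BirchSwinnertonDyer.BirchSwinnertonDyer.Theorems.GenusKolyArch

end
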